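import Mathlib
import HarnessLib
import Summits.AtomisticToContinuum.FouriersLaw.Theses.JunctionLocality
import Summits.AtomisticToContinuum.FouriersLaw.Theorems.JunctionLocalityDefs
import Summits.AtomisticToContinuum.FouriersLaw.Theorems.OddSectorIrreversibilityCorrectorTheoryUniformMixing
import Summits.AtomisticToContinuum.FouriersLaw.Theorems.HonestZwanzigFeshbachIdentitiesCorrelations

/-!
# Stub `stub_kickResponseIdentity` (K) of line `kick-dipole-no-collapse` — crux `JunctionLocality.ConductanceLowerBound`
# (stmt-AtomisticToContinuum-11749): `𝒥_N ∈ L¹(0,∞)` and `D_N = ∫₀^∞ 𝒥_N`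

For the pinned anharmonic chain `P = pinnedChain ω₂ lam β γ` (all parameters `> 0`), under the hypotheses of the crux
(weak steady-state uniqueness, a steady-state family `μ`, `T > 0`, clause-(ii) response coefficients
`D_N = lim_{δ→0, δ≠0} J_N(μ_{N,T+δ/2,T-δ/2})/δ`) and for every `N ≥ 2`, the KICK-RESPONSE KERNEL
`𝒥_N(s) = kickKernel P N T s = T⁻² ∫ g · (κ_s J) dμ_T` (`g = kdnSource P N = (γ/2)(p_0² − p_{N−1}²)`, `J = Σ_i j_i`,
equal-temperature kernels `κ_s = transitionKernel N T T s⁺`, Gibbs measure `μ_T`; `Theorems/JunctionLocalityDefs.lean`)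
is integrable on `(0,∞)` and `D_N = ∫₀^∞ 𝒥_N` (`stub_kickResponseIdentity`, the registered sub-goal, stated verbatim).

This is a COMPOSITION OF LANDED RESULTS — the Kundu–Dhar–Narayan response formula BEFORE its Green–Kubo conversion:

* (★) the exact response identity `J_N(μ_δ) = (δ/T²)·I(δ)`, `I(δ) = ∫₀^∞ ∫ g · (κ^δ_s J) dμ_T ds` with the NESS kernels
  `κ^δ_s = transitionKernel N (T+δ/2) (T-δ/2) s⁺`, for `0 < |δ| < 2T`
  (`OpenChainGreenKubo.totalCurrent_eq_bias_mul_pairing`, `Theorems/HonestZwanzigOpenChainGreenKuboStar.lean`);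
* (CONT) `I(δ) → I(0)` along `δ → 0`, `δ ≠ 0` (`OpenChainGreenKubo.tendsto_pairing_of_uniform_decay`, fed with the uniform
  relaxation estimate `OddSectorIrreversibility.Corrector.uniformDecay_totalCurrent`, CEHR 2018 (2.5) with constants uniform
  in the bias);
* hence `J_N(μ_δ)/δ = I(δ)/T² → I(0)/T²` along `𝓝[≠] 0`, and `D_N = I(0)/T²` by uniqueness of limits;
* `I(0)/T² = ∫₀^∞ 𝒥_N` because `𝒥_N(s) = T⁻² ∫ g · (κ_s J) dμ_T` pointwise (`kickKernel_def`, `kdnSource_of_pos`,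
  `(pinnedChain …).γ = γ`), and `s ↦ ∫ g · (κ_s J) dμ_T` is integrable on `(0,∞)` as an equilibrium correlation of two nice
  observables (`HonestZwanzig.pinnedChain_integrableOn_corr_nice`, CEHR (2.5) at equal temperatures; `μ_T(J) = 0` by momentum
  parity, `integral_totalBondCurrent_gibbsMeasure`).

No definitions, no named facts, no new hypotheses.
-/

noncomputable section

open MeasureTheory Filter Topology Set
open scoped NNReal BigOperators

namespace Summit.AtomisticToContinuum.FouriersLaw.Cruxes.ConductanceLowerBound.KickDipoleNoCollapse

open Literature.MathematicalPhysics.KineticTheory.HeatConduction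
open Summit.AtomisticToContinuum.FouriersLaw.Theorems.JunctionLocality
open Summit.AtomisticToContinuum.FouriersLaw.Theorems
open Summit.AtomisticToContinuum.FouriersLaw.Theorems.OddSectorIrreversibility.Corrector

/-- **The kick kernel of the pinned chain, unfolded to the tree's kernels**: for `N ≥ 2`,
`𝒥_N(s) = T⁻² ∫ (γ/2)(p_0² − p_{N−1}²) · (∫ J dκ_s) dμ_T` — verbatim the `δ = 0` integrand of the pairing `I(δ)` of
`OpenChainGreenKubo.tendsto_pairing_of_uniform_decay` (`kickKernel_def`, `kdnSource_of_pos`, `(pinnedChain …).γ = γ`).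
[folklore] -/
theorem kickKernel_pinnedChain_eq {ω₂ lam β γ : ℝ} {N : ℕ} (hN : 2 ≤ N) (T s : ℝ) :
    kickKernel (pinnedChain ω₂ lam β γ) N T s = 1 / T ^ 2 * ∫ x,
        γ / 2 * (x.2 ⟨0, by omega⟩ ^ 2 - x.2 ⟨N - 1, by omega⟩ ^ 2) *
          (∫ y, (∑ i : Fin N, (pinnedChain ω₂ lam β γ).bondCurrent N i y)
            ∂((pinnedChain ω₂ lam β γ).transitionKernel N T T s.toNNReal x))
        ∂((pinnedChain ω₂ lam β γ).gibbsMeasure N T) := by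
  rw [kickKernel_def]
  congr 1
  refine integral_congr_ae (Eventually.of_forall fun x => ?_)
  beta_reduce
  rw [kdnSource_of_pos _ (show 0 < N by omega)]
  rfl

/-- **The equilibrium kick pairing is integrable on `(0,∞)`**: for all parameters `> 0`, `T > 0`, `N ≥ 2`,
`s ↦ ∫ (γ/2)(p_0² − p_{N−1}²) · (κ_s J) dμ_T` is integrable on `(0,∞)` — an equilibrium correlation of the two nice
(continuous, `O(e^{ϑH})` with `ϑ = 1/(4T)`) observables `g` and `J`, exponentially mixing by CEHR (2.5) at equal
temperatures (`HonestZwanzig.pinnedChain_integrableOn_corr_nice`), the subtracted product of means vanishing since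
`μ_T(J) = 0`. [cite: CuneoEckmannHairerReyBellet2018, Thm 2.13 (3)] -/
theorem integrableOn_kickPairing {ω₂ lam β γ : ℝ} (hω : 0 < ω₂) (hl : 0 < lam) (hβ : 0 < β) (hγ : 0 < γ)
    {N : ℕ} (hN : 2 ≤ N) {T : ℝ} (hT : 0 < T) :
    IntegrableOn (fun s : ℝ => ∫ x,
        γ / 2 * (x.2 ⟨0, by omega⟩ ^ 2 - x.2 ⟨N - 1, by omega⟩ ^ 2) *
          (∫ y, (∑ i : Fin N, (pinnedChain ω₂ lam β γ).bondCurrent N i y)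
            ∂((pinnedChain ω₂ lam β γ).transitionKernel N T T s.toNNReal x))
        ∂((pinnedChain ω₂ lam β γ).gibbsMeasure N T)) (Ioi 0) := by
  have hN0 : 0 < N := by omega
  have hN1 : N - 1 < N := by omega
  obtain ⟨hϑ0, h2ϑ⟩ := LightConeBondHeat.quarter_inv_temp_admissible hT
  obtain ⟨M, hM0, hJM⟩ := abs_totalBondCurrent_le_exp hω.le hl.le hβ.le γ N hϑ0
  have hJc := continuous_totalBondCurrent ω₂ lam β γ N
  have hgc : Continuous fun x : PhaseSpace N => γ / 2 * (x.2 ⟨0, hN0⟩ ^ 2 - x.2 ⟨N - 1, hN1⟩ ^ 2) :=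
    continuous_const.mul ((((continuous_apply _).comp continuous_snd).pow 2).sub
      (((continuous_apply _).comp continuous_snd).pow 2))
  obtain ⟨Cg, hCg0, hgb⟩ : ∃ Cg : ℝ, 0 ≤ Cg ∧ ∀ y : PhaseSpace N,
      |γ / 2 * (y.2 ⟨0, hN0⟩ ^ 2 - y.2 ⟨N - 1, hN1⟩ ^ 2)| ≤
        Cg * Real.exp (1 / (4 * T) * (pinnedChain ω₂ lam β γ).hamiltonian N y) := by
    refine ⟨|γ| / 1 ^ 2 * (2 * Real.exp (1 / (4 * T)) / (1 / (4 * T)) ^ 2), by positivity, fun y => ?_⟩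
    have h := OddSectorIrreversibility.pinnedChain_abs_mclennanSource_le hω hl.le hβ.le N (γ := γ) (T := 1) hϑ0
      ⟨0, hN0⟩ ⟨N - 1, hN1⟩ y
    have e : γ / (2 * (1 : ℝ) ^ 2) = γ / 2 := by norm_num
    rw [e] at h
    exact h
  have h := HonestZwanzig.pinnedChain_integrableOn_corr_nice hω hl.le hβ hγ hN0 hT hϑ0 h2ϑ hgc hJc hCg0 hM0 hgb hJM
  simpa only [integral_totalBondCurrent_gibbsMeasure, mul_zero, sub_zero] using h

/-- **K — KICK-RESPONSE IDENTITY (registered stub `stub_kickResponseIdentity` of line `kick-dipole-no-collapse`,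
crux stmt-AtomisticToContinuum-11749).**  Under the crux's hypotheses (weak-NESS uniqueness, a steady-state family `μ`,
`T > 0`, clause-(ii) response coefficients `D`): for every `N ≥ 2` the kick kernel `𝒥_N = kickKernel (pinnedChain …) N T`
is integrable on `(0,∞)` and `D_N = ∫₀^∞ 𝒥_N`.  Proof: (★) `J_N(μ_δ) = (δ/T²) I(δ)` for `0 < |δ| < 2T`
(`OpenChainGreenKubo.totalCurrent_eq_bias_mul_pairing`), so `J_N(μ_δ)/δ = I(δ)/T²` eventually along `𝓝[≠] 0`; (CONT)
`I(δ) → I(0)` (`OpenChainGreenKubo.tendsto_pairing_of_uniform_decay` with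
`OddSectorIrreversibility.Corrector.uniformDecay_totalCurrent`); uniqueness of limits gives `D_N = I(0)/T²`, and
`I(0)/T² = ∫₀^∞ 𝒥_N` by `kickKernel_pinnedChain_eq` (integrability: `integrableOn_kickPairing`).
[cite: KunduDharNarayan2009, p. 3] [cite: CuneoEckmannHairerReyBellet2018, Thm 2.13 eq. (2.5)] -/
theorem stub_kickResponseIdentity : ∀ ω₂ lam β γ : ℝ, 0 < ω₂ → 0 < lam → 0 < β → 0 < γ → (∀ (N : ℕ) (T_L T_R : ℝ), 0 < T_L → 0 < T_R → ∀ μ ν : Measure (PhaseSpace N), (pinnedChain ω₂ lam β γ).IsSteadyState N T_L T_R μ → (pinnedChain ω₂ lam β γ).IsSteadyState N T_L T_R ν → μ = ν) → ∀ μ : (N : ℕ) → ℝ → ℝ → Measure (PhaseSpace N), (∀ (N : ℕ) (T_L T_R : ℝ), 0 < T_L → 0 < T_R → (pinnedChain ω₂ lam β γ).IsSteadyState N T_L T_R (μ N T_L T_R)) → ∀ T : ℝ, 0 < T → ∀ D : ℕ → ℝ, (∀ N : ℕ, Tendsto (fun δ : ℝ => (pinnedChain ω₂ lam β γ).totalCurrent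 (μ N (T + δ / 2) (T - δ / 2)) / δ) (𝓝[≠] 0) (𝓝 (D N))) → ∀ N : ℕ, 2 ≤ N → IntegrableOn (fun s : ℝ => kickKernel (pinnedChain ω₂ lam β γ) N T s) (Ioi 0) ∧ D N = ∫ s in Ioi (0 : ℝ), kickKernel (pinnedChain ω₂ lam β γ) N T s := by
  intro ω₂ lam β γ hω hl hβ hγ huniq μ hμ T hT D hD N hN
  have hN0 : 0 < N := by omega
  have hN1 : N - 1 < N := by omega
  have hT2 : (0 : ℝ) < T ^ 2 := by positivity
  -- the NESS-kernel pairing `s ↦ ∫ g · (κ^δ_s J) dμ_T` and its equilibrium value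
  set F : ℝ → ℝ → ℝ := fun δ s => ∫ x,
      γ / 2 * (x.2 ⟨0, hN0⟩ ^ 2 - x.2 ⟨N - 1, hN1⟩ ^ 2) *
        (∫ y, (∑ i : Fin N, (pinnedChain ω₂ lam β γ).bondCurrent N i y)
          ∂((pinnedChain ω₂ lam β γ).transitionKernel N (T + δ / 2) (T - δ / 2) s.toNNReal x))
      ∂((pinnedChain ω₂ lam β γ).gibbsMeasure N T) with hF
  set F₀ : ℝ → ℝ := fun s => ∫ x,
      γ / 2 * (x.2 ⟨0, hN0⟩ ^ 2 - x.2 ⟨N - 1, hN1⟩ ^ 2) *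
        (∫ y, (∑ i : Fin N, (pinnedChain ω₂ lam β γ).bondCurrent N i y)
          ∂((pinnedChain ω₂ lam β γ).transitionKernel N T T s.toNNReal x))
      ∂((pinnedChain ω₂ lam β γ).gibbsMeasure N T) with hF₀
  -- (CONT): `I(δ) → I(0)` along `δ → 0`, `δ ≠ 0`
  have hcont : Tendsto (fun δ : ℝ => ∫ s in Ioi (0 : ℝ), F δ s) (𝓝[≠] 0) (𝓝 (∫ s in Ioi (0 : ℝ), F₀ s)) :=
    OpenChainGreenKubo.tendsto_pairing_of_uniform_decay hω hl hβ hγ hN hT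
      (uniformDecay_totalCurrent ω₂ lam β γ hω hl hβ hγ T hT N hN)
  -- (★): the response quotient IS `I(δ)/T²` for `0 < |δ| < 2T`
  have hev : ∀ᶠ δ in 𝓝[≠] (0 : ℝ), (∫ s in Ioi (0 : ℝ), F δ s) / T ^ 2 =
      (pinnedChain ω₂ lam β γ).totalCurrent (μ N (T + δ / 2) (T - δ / 2)) / δ := by
    have h1 : ∀ᶠ δ in 𝓝 (0 : ℝ), |δ| < 2 * T := by
      have : ∀ᶠ δ in 𝓝 (0 : ℝ), δ ∈ Ioo (-(2 * T)) (2 * T) := Ioo_mem_nhds (by linarith) (by linarith)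
      filter_upwards [this] with δ hδ
      exact abs_lt.2 ⟨hδ.1, hδ.2⟩
    filter_upwards [mem_nhdsWithin_of_mem_nhds h1, self_mem_nhdsWithin] with δ hδ hδ0
    have hδ0' : δ ≠ 0 := hδ0
    have hδ' := abs_lt.1 hδ
    have hTL : 0 < T + δ / 2 := by linarith
    have hTR : 0 < T - δ / 2 := by linarith
    have hs : (pinnedChain ω₂ lam β γ).totalCurrent (μ N (T + δ / 2) (T - δ / 2)) =
        δ / T ^ 2 * ∫ s in Ioi (0 : ℝ), F δ s :=
      OpenChainGreenKubo.totalCurrent_eq_bias_mul_pairing hω hl hβ hγ hN0 hT hδ0' hδ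
        (huniq N (T + δ / 2) (T - δ / 2) hTL hTR) (hμ N (T + δ / 2) (T - δ / 2) hTL hTR) hN
    rw [hs]
    field_simp
  -- uniqueness of limits along `𝓝[≠] 0`
  have hlim := (hcont.div_const (T ^ 2)).congr' hev
  have hDN : D N = (∫ s in Ioi (0 : ℝ), F₀ s) / T ^ 2 := tendsto_nhds_unique (hD N) hlim
  -- identify the kick kernel with `T⁻² F₀`
  have hF₀i : IntegrableOn F₀ (Ioi 0) := integrableOn_kickPairing hω hl hβ hγ hN hT
  have hk : (fun s : ℝ => kickKernel (pinnedChain ω₂ lam β γ) N T s) = fun s => 1 / T ^ 2 * F₀ s :=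
    funext fun s => kickKernel_pinnedChain_eq hN T s
  refine ⟨?_, ?_⟩
  · rw [hk]
    exact hF₀i.const_mul _
  · rw [hk, integral_const_mul, hDN]
    ring

end Summit.AtomisticToContinuum.FouriersLaw.Cruxes.ConductanceLowerBound.KickDipoleNoCollapse

end
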